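import Literature.ModelTheory.ExponentialFields.KhovanskiiCurve
import Literature.Analysis.Calculus.RegularZeroSet
import Mathlib.Analysis.Calculus.LagrangeMultipliers
import Mathlib.Topology.MetricSpace.Thickening
import HarnessLib

/-!
# Khovanskii's component count I: local minima of the squared distance near a component

Topic `Literature/ModelTheory/ExponentialFields`. Analytic preliminaries of the Morse-theoretic
step of Khovanskii's theory (A. G. Khovanskii, *Fewnomials* (1991), Ch. III §§3.8–3.14; for
A. J. Wilkie, Illinois J. Math. 33 (1989), §5), for the real zero set `W = {g(β, ·) = 0}` of a
system of `L_exp`-terms all of whose zeros are regular. Everything is **proved**: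

* `Khovanskii.zeroSetR`, `isOpen_setOf_linearIndependent_grad`, `hasStrictFDerivAt_sysFun_of_regular`
  — the zero set, openness of regularity, local submersivity;
* `Khovanskii.sqd c` — the squared distance `Σ (zⱼ - cⱼ)²`, its derivative and compact sublevel
  sets;
* `Khovanskii.exists_multipliers` — the Lagrange multiplier theorem (Mathlib
  `IsLocalExtrOn.exists_multipliers_of_hasStrictFDerivAt`) packaged: at a local minimum of `sqd c`
  on a level set of `g(β, ·)` with independent gradients, `z - c = Σ λᵢ ∇gᵢ(β, z)`;
* `Khovanskii.exists_forall_isLocalMinOn` — **for all levels `e` and centres `c` close to `0`,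
  `sqd c` has a local minimum on `{g(β, ·) = e}` inside a prescribed compact collar `U` of a compact
  piece of a component of `W`** (compactness, local solvability at regular points
  `RegularZeroSet.lean`, openness of regularity).

The count of components is completed in `KhovanskiiComponents.lean`.

## References

* A. G. Khovanskii, *Fewnomials*, Transl. Math. Monogr. 88, AMS (1991), Ch. III. [Khovanskii1991]
* A. J. Wilkie, *On the theory of the real exponential field*, Illinois J. Math. 33 (1989), §5,
  Proposition (p. 402). [Wilkie1989]
* J. Milnor, *Topology from the Differentiable Viewpoint* (1965), §1–§2. [MilnorTDV1965]
-/

noncomputable section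

open FirstOrder FirstOrder.Language FirstOrder.Language.Structure
open Set Filter Metric MeasureTheory
open scoped Topology

namespace Literature.ModelTheory.ExponentialFields

namespace Khovanskii

open ExpTerm RealExpModel

variable {m k q : ℕ} (g : Fin q → Language.orderedExpRing.Term (Fin m ⊕ Fin k)) (β : Fin m → ℝ)

/-! ### The real zero set and regularity -/

/-- The real zero set of `g` at parameters `β`. [folklore] -/
def zeroSetR : Set (Fin k → ℝ) := {z | sysFun g β z = 0}

/-- Membership in the real zero set. [folklore] -/
theorem mem_zeroSetR {z : Fin k → ℝ} : z ∈ zeroSetR g β ↔ ∀ i, (g i).realize (Sum.elim β z) = 0 := by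
  rw [zeroSetR, mem_setOf_eq, funext_iff]
  rfl

/-- The real zero set is closed. [folklore] -/
theorem isClosed_zeroSetR : IsClosed (zeroSetR g β) :=
  isClosed_eq (contDiff_sysFun g β (m := 0)).continuous continuous_const

/-- Regular points (independent gradient rows) form an open set. [folklore] -/
theorem isOpen_setOf_linearIndependent_grad :
    IsOpen {z : Fin k → ℝ | LinearIndependent ℝ (fun i => grad (g i) β z)} := by
  have e : {z : Fin k → ℝ | LinearIndependent ℝ (fun i => grad (g i) β z)} =
      ⋃ I : Fin q → Fin k, {z | (minorTerm g I).realize (Sum.elim β z) ≠ 0} := by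
    ext z
    simp only [mem_setOf_eq, mem_iUnion, realize_minorTerm]
    exact linearIndependent_rows_iff_exists_det_submatrix_ne_zero (Matrix.of fun i => grad (g i) β z)
  rw [e]
  exact isOpen_iUnion fun I => isOpen_ne_fun (continuous_realize _ β) continuous_const

/-- At a regular zero, `z ↦ g(β, z)` is strictly differentiable with onto derivative. [folklore] -/
theorem hasStrictFDerivAt_sysFun_of_regular {z : Fin k → ℝ}
    (hli : LinearIndependent ℝ (fun i => grad (g i) β z)) :
    HasStrictFDerivAt (sysFun g β) (fderiv ℝ (sysFun g β) z) z ∧ (fderiv ℝ (sysFun g β) z).range = ⊤ :=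
  ⟨(contDiff_sysFun g β (m := 1)).contDiffAt.hasStrictFDerivAt one_ne_zero,
    range_fderiv_sysFun_eq_top g β z hli⟩

/-! ### The squared distance -/

/-- The squared distance `Σⱼ (zⱼ - cⱼ)²` from `c`. [folklore] -/
def sqd (c z : Fin k → ℝ) : ℝ := ∑ j, (z j - c j) * (z j - c j)

omit m q in
/-- Joint continuity of the squared distance. [folklore] -/
theorem continuous_sqd : Continuous (fun p : (Fin k → ℝ) × (Fin k → ℝ) => sqd p.1 p.2) := by
  unfold sqd
  fun_prop

omit m q in
/-- Continuity of `z ↦ sqd c z`. [folklore] -/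
theorem continuous_sqd_right (c : Fin k → ℝ) : Continuous (sqd c) := by
  unfold sqd
  fun_prop

omit m q in
/-- The squared distance is smooth in `z`. [folklore] -/
theorem contDiff_sqd (c : Fin k → ℝ) {n : WithTop ℕ∞} : ContDiff ℝ n (sqd c) := by
  unfold sqd
  fun_prop

omit m q in
/-- The derivative of the squared distance. [folklore] -/
theorem hasFDerivAt_sqd (c z : Fin k → ℝ) :
    HasFDerivAt (sqd c) (∑ j, ((z j - c j) • ContinuousLinearMap.proj (R := ℝ) (φ := fun _ : Fin k => ℝ) j +
      (z j - c j) • ContinuousLinearMap.proj (R := ℝ) (φ := fun _ : Fin k => ℝ) j)) z := by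
  unfold sqd
  refine HasFDerivAt.fun_sum fun j _ => ?_
  have h1 : HasFDerivAt (fun x : Fin k → ℝ => x j - c j)
      (ContinuousLinearMap.proj (R := ℝ) (φ := fun _ : Fin k => ℝ) j) z :=
    (hasFDerivAt_apply j z).sub_const (c j)
  exact h1.mul h1

omit m q in
/-- The partial derivatives of the squared distance: `∂ⱼ sqd c = 2 (zⱼ - cⱼ)`. [folklore] -/
theorem fderiv_sqd_single (c z : Fin k → ℝ) (j : Fin k) :
    fderiv ℝ (sqd c) z (Pi.single j 1) = 2 * (z j - c j) := by
  classical
  rw [(hasFDerivAt_sqd c z).fderiv]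
  simp [Pi.single_apply, Finset.sum_add_distrib]
  ring

omit m q in
/-- `|zⱼ| ≤ √(sqd 0 z)`. [folklore] -/
theorem abs_le_sqrt_sqd_zero (z : Fin k → ℝ) (j : Fin k) : |z j| ≤ Real.sqrt (sqd 0 z) := by
  refine Real.abs_le_sqrt ?_
  rw [sqd]
  have : z j ^ 2 = (z j - 0) * (z j - 0) := by ring
  rw [this]
  exact Finset.single_le_sum (fun i _ => mul_self_nonneg (z i - 0)) (Finset.mem_univ j)

omit m q in
/-- The sublevel sets `{sqd 0 ≤ R}` are compact. [folklore] -/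
theorem isCompact_setOf_sqd_zero_le (R : ℝ) : IsCompact {z : Fin k → ℝ | sqd 0 z ≤ R} := by
  refine (isCompact_closedBall (0 : Fin k → ℝ) (Real.sqrt R)).of_isClosed_subset
    (isClosed_le (continuous_sqd_right 0) continuous_const) fun z hz => ?_
  rw [mem_closedBall, dist_zero_right, pi_norm_le_iff_of_nonneg (Real.sqrt_nonneg R)]
  intro j
  rw [Real.norm_eq_abs]
  exact (abs_le_sqrt_sqd_zero z j).trans (Real.sqrt_le_sqrt hz)

/-! ### The Lagrange multiplier theorem, packaged -/

/-- **Lagrange multipliers**: at a local minimum `z` of `sqd c` on the level set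
`{g(β, ·) = e}` with independent gradient rows there are `λᵢ` with `z - c = Σ λᵢ ∇gᵢ(β, z)`.
[folklore] -/
theorem exists_multipliers {c z : Fin k → ℝ} {e : Fin q → ℝ}
    (hlev : ∀ i, (g i).realize (Sum.elim β z) = e i)
    (hli : LinearIndependent ℝ (fun i => grad (g i) β z))
    (hmin : IsLocalMinOn (sqd c) {z' | ∀ i, (g i).realize (Sum.elim β z') = e i} z) :
    ∃ lam : Fin q → ℝ, ∀ j, z j - c j = ∑ i, lam i * grad (g i) β z j := by
  classical
  set f : Fin q → (Fin k → ℝ) → ℝ := fun i x => (g i).realize (Sum.elim β x) with hf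
  have hset : {z' : Fin k → ℝ | ∀ i, (g i).realize (Sum.elim β z') = e i} = {x | ∀ i, f i x = f i z} := by
    ext x
    simp only [mem_setOf_eq, hf, hlev]
  rw [hset] at hmin
  have hextr : IsLocalExtrOn (sqd c) {x | ∀ i, f i x = f i z} z := IsMinFilter.isExtr hmin
  have hf' : ∀ i, HasStrictFDerivAt (f i) (fderiv ℝ (f i) z) z := fun i =>
    hasStrictFDerivAt_realize (g i) β z
  have hφ' : HasStrictFDerivAt (sqd c) (fderiv ℝ (sqd c) z) z :=
    (contDiff_sqd c (n := 1)).contDiffAt.hasStrictFDerivAt one_ne_zero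
  obtain ⟨Λ, Λ₀, hne, hsum⟩ := hextr.exists_multipliers_of_hasStrictFDerivAt hf' hφ'
  -- evaluate at the coordinate vectors
  have hcoord : ∀ j, ∑ i, Λ i * grad (g i) β z j + Λ₀ * (2 * (z j - c j)) = 0 := by
    intro j
    have h := congrArg (fun L : (Fin k → ℝ) →L[ℝ] ℝ => L (Pi.single j 1)) hsum
    simp only [hf] at h
    simp [fderiv_realize_single, fderiv_sqd_single] at h
    simp only [grad_apply]
    linear_combination h
  have hΛ₀ : Λ₀ ≠ 0 := by
    intro h0
    apply hne
    have hΛ : Λ = 0 := by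
      have h1 : ∑ i, Λ i • grad (g i) β z = 0 := by
        funext j
        have := hcoord j
        rw [h0, zero_mul, add_zero] at this
        simpa [Finset.sum_apply, Pi.smul_apply, smul_eq_mul] using this
      exact funext fun i => Fintype.linearIndependent_iff.1 hli Λ h1 i
    rw [hΛ, h0]
    rfl
  refine ⟨fun i => -Λ i / (2 * Λ₀), fun j => ?_⟩
  have h := hcoord j
  have h2 : (2 : ℝ) * Λ₀ ≠ 0 := mul_ne_zero two_ne_zero hΛ₀
  have e1 : ∑ i, (-Λ i / (2 * Λ₀)) * grad (g i) β z j =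
      (-(∑ i, Λ i * grad (g i) β z j)) / (2 * Λ₀) := by
    rw [← Finset.sum_neg_distrib, Finset.sum_div]
    exact Finset.sum_congr rfl fun i _ => by ring
  rw [e1]
  field_simp
  linarith

/-! ### Local minima of the squared distance near a compact piece of a component -/

/-- **Existence of local minima in a collar, uniformly for small levels and centres.** Let every
zero of `g(β, ·)` be regular, `K ⊆ zeroSetR` with compact nonempty piece
`Kc = K ∩ {sqd 0 ≤ R}`, and `U` a compact set with `U ∩ zeroSetR ⊆ K` containing the
`η`-thickening of `Kc`. Then for all `θ = (c, e)` small enough, the squared distance `sqd c` has,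
inside `U`, a local minimum on the level set `{g(β, ·) = e}` at a regular point. [cite: Khovanskii1991, Ch. III] -/
theorem exists_forall_isLocalMinOn
    (hreg : ∀ z ∈ zeroSetR g β, LinearIndependent ℝ (fun i => grad (g i) β z))
    {K U Kc : Set (Fin k → ℝ)} {R η : ℝ} (hKW : K ⊆ zeroSetR g β)
    (hKc : Kc = K ∩ {z | sqd 0 z ≤ R}) (hKcne : Kc.Nonempty) (hKcc : IsCompact Kc)
    (hUc : IsCompact U) (hUW : U ∩ zeroSetR g β ⊆ K) (hη : 0 < η) (hthick : thickening η Kc ⊆ U) :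
    ∃ ε > 0, ∀ θ : Fin (k + q) → ℝ, ‖θ‖ < ε →
      ∃ z ∈ U, (∀ i, (g i).realize (Sum.elim β z) = θ (Fin.natAdd k i)) ∧
        LinearIndependent ℝ (fun i => grad (g i) β z) ∧
        IsLocalMinOn (sqd fun j => θ (Fin.castAdd q j))
          {z' | ∀ i, (g i).realize (Sum.elim β z') = θ (Fin.natAdd k i)} z := by
  classical
  by_contra H
  push Not at H
  -- bad parameters `θ n → 0`
  have H' : ∀ n : ℕ, ∃ θ : Fin (k + q) → ℝ, ‖θ‖ < 1 / ((n : ℝ) + 1) ∧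
      ∀ z ∈ U, (∀ i, (g i).realize (Sum.elim β z) = θ (Fin.natAdd k i)) →
        LinearIndependent ℝ (fun i => grad (g i) β z) →
          ¬ IsLocalMinOn (sqd fun j => θ (Fin.castAdd q j))
            {z' | ∀ i, (g i).realize (Sum.elim β z') = θ (Fin.natAdd k i)} z :=
    fun n => H _ (by positivity)
  choose θ hθ hbad using H'
  set e : ℕ → Fin q → ℝ := fun n i => θ n (Fin.natAdd k i) with he
  set c : ℕ → Fin k → ℝ := fun n j => θ n (Fin.castAdd q j) with hc
  have hθ0 : Tendsto θ atTop (𝓝 0) := by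
    rw [tendsto_zero_iff_norm_tendsto_zero]
    refine squeeze_zero (fun n => norm_nonneg _) (fun n => (hθ n).le) ?_
    exact tendsto_one_div_add_atTop_nhds_zero_nat
  have he0 : Tendsto e atTop (𝓝 0) := by
    rw [tendsto_pi_nhds]
    intro i
    exact (continuous_apply (Fin.natAdd k i)).continuousAt.tendsto.comp hθ0
  have hc0 : Tendsto c atTop (𝓝 0) := by
    rw [tendsto_pi_nhds]
    intro j
    exact (continuous_apply (Fin.castAdd q j)).continuousAt.tendsto.comp hθ0
  -- the minimum `b` of `sqd 0` on `Kc`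
  obtain ⟨b, hbKc, hbmin⟩ := hKcc.exists_isMinOn hKcne (continuous_sqd_right 0).continuousOn
  have hbK : b ∈ K := by rw [hKc] at hbKc; exact hbKc.1
  have hbW : b ∈ zeroSetR g β := hKW hbK
  have hbU : b ∈ U := hthick (mem_thickening_iff.2 ⟨b, hbKc, by rw [dist_self]; exact hη⟩)
  have hbreg := hasStrictFDerivAt_sysFun_of_regular g β (hreg b hbW)
  -- level sets and their compact traces on `U`
  set L : ℕ → Set (Fin k → ℝ) := fun n => {z' | ∀ i, (g i).realize (Sum.elim β z') = e n i} with hL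
  have hLeq : ∀ n, L n = {z' | sysFun g β z' = e n} := fun n => by
    ext z'; simp only [hL, mem_setOf_eq, funext_iff]; rfl
  have hLc : ∀ n, IsClosed (L n) := fun n => by
    rw [hLeq]; exact isClosed_eq (contDiff_sysFun g β (m := 0)).continuous continuous_const
  -- local solvability at `b`: eventually the trace is nonempty, with a point near `b`
  have hsolv : ∀ δ > 0, ∀ᶠ n in atTop, ∃ y ∈ ball b δ, y ∈ L n := by
    intro δ hδ
    have h1 := Literature.Analysis.Calculus.eventually_exists_mem_eq hbreg.1 hbreg.2
      (ball_mem_nhds b hδ)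
    have h2 : sysFun g β b = 0 := hbW
    rw [h2] at h1
    have h3 := he0.eventually h1
    filter_upwards [h3] with n hn
    obtain ⟨y, hy, hye⟩ := hn
    refine ⟨y, hy, ?_⟩
    rw [hLeq]; exact hye
  -- minimisers `z n ∈ U` of `sqd (c n)` on `U ∩ L n` (or `b` if the trace is empty)
  have hmin : ∀ n, ∃ z ∈ U, ((U ∩ L n).Nonempty → z ∈ L n ∧ IsMinOn (sqd (c n)) (U ∩ L n) z) := by
    intro n
    by_cases hne : (U ∩ L n).Nonempty
    · obtain ⟨z, hz, hzmin⟩ := (hUc.inter_right (hLc n)).exists_isMinOn hne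
        (continuous_sqd_right (c n)).continuousOn
      exact ⟨z, hz.1, fun _ => ⟨hz.2, hzmin⟩⟩
    · exact ⟨b, hbU, fun h => (hne h).elim⟩
  choose z hzU hz using hmin
  -- a convergent subsequence
  obtain ⟨zs, hzsU, φ, hφ, hlim⟩ := hUc.tendsto_subseq hzU
  have hφt : Tendsto φ atTop atTop := hφ.tendsto_atTop
  -- eventually the trace is nonempty
  have hne_ev : ∀ᶠ n in atTop, (U ∩ L n).Nonempty := by
    filter_upwards [hsolv (η / 2) (by positivity)] with n hn
    obtain ⟨y, hy, hyL⟩ := hn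
    refine ⟨y, hthick (mem_thickening_iff.2 ⟨b, hbKc, ?_⟩), hyL⟩
    rw [mem_ball] at hy; linarith
  have hzL : ∀ᶠ p in atTop, z (φ p) ∈ L (φ p) ∧ IsMinOn (sqd (c (φ p))) (U ∩ L (φ p)) (z (φ p)) := by
    filter_upwards [hφt.eventually hne_ev] with p hp
    exact hz (φ p) hp
  -- the limit lies on the zero set
  have hzsW : zs ∈ zeroSetR g β := by
    rw [mem_zeroSetR]
    intro i
    have h1 : Tendsto (fun p => (g i).realize (Sum.elim β (z (φ p)))) atTop
        (𝓝 ((g i).realize (Sum.elim β zs))) :=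
      ((continuous_realize (g i) β).tendsto zs).comp hlim
    have h2 : Tendsto (fun p => (g i).realize (Sum.elim β (z (φ p)))) atTop (𝓝 0) := by
      have h3 : Tendsto (fun p => e (φ p) i) atTop (𝓝 0) := by
        have := (tendsto_pi_nhds.1 he0 i).comp hφt
        exact this
      refine h3.congr' ?_
      filter_upwards [hzL] with p hp
      exact (hp.1 i).symm
    exact tendsto_nhds_unique h1 h2
  have hzsK : zs ∈ K := hUW ⟨hzsU, hzsW⟩
  -- the limit has `sqd 0 zs ≤ sqd 0 b`
  have hval : Tendsto (fun p => sqd (c (φ p)) (z (φ p))) atTop (𝓝 (sqd 0 zs)) := by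
    have h1 : Tendsto (fun p => (c (φ p), z (φ p))) atTop (𝓝 ((0 : Fin k → ℝ), zs)) :=
      (hc0.comp hφt).prodMk_nhds hlim
    exact (continuous_sqd.tendsto _).comp h1
  have hupper : ∀ δ, 0 < δ → δ < η → sqd 0 zs ≤ ∑ j, (|b j| + 2 * δ) * (|b j| + 2 * δ) := by
    intro δ hδ hδη
    have hcδ : ∀ᶠ p in atTop, ‖c (φ p)‖ < δ := by
      have := (tendsto_zero_iff_norm_tendsto_zero.1 hc0).comp hφt
      exact this.eventually (gt_mem_nhds hδ)
    have hev : ∀ᶠ p in atTop, sqd (c (φ p)) (z (φ p)) ≤ ∑ j, (|b j| + 2 * δ) * (|b j| + 2 * δ) := by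
      filter_upwards [hzL, hφt.eventually (hsolv δ hδ), hcδ] with p hp hy hcp
      obtain ⟨y, hyb, hyL⟩ := hy
      have hyU : y ∈ U := hthick (mem_thickening_iff.2 ⟨b, hbKc, (mem_ball.1 hyb).trans hδη⟩)
      have h1 : sqd (c (φ p)) (z (φ p)) ≤ sqd (c (φ p)) y := isMinOn_iff.1 hp.2 y ⟨hyU, hyL⟩
      refine h1.trans (Finset.sum_le_sum fun j _ => ?_)
      have hyj : |y j - b j| < δ := by
        rw [mem_ball, dist_eq_norm] at hyb
        exact (norm_le_pi_norm (y - b) j).trans_lt hyb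
      have hcj : |c (φ p) j| < δ := (norm_le_pi_norm (c (φ p)) j).trans_lt hcp
      have habs : |y j - c (φ p) j| ≤ |b j| + 2 * δ := by
        have : y j - c (φ p) j = (y j - b j) + b j + -(c (φ p) j) := by ring
        rw [this]
        refine (abs_add_three _ _ _).trans ?_
        rw [abs_neg]
        linarith
      nlinarith [abs_nonneg (y j - c (φ p) j), abs_mul_abs_self (y j - c (φ p) j),
        abs_nonneg (b j)]
    exact le_of_tendsto hval hev
  have hle : sqd 0 zs ≤ sqd 0 b := by
    have hF : Tendsto (fun δ : ℝ => ∑ j, (|b j| + 2 * δ) * (|b j| + 2 * δ)) (𝓝[>] 0)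
        (𝓝 (∑ j, (|b j| + 2 * 0) * (|b j| + 2 * 0))) := by
      refine (Continuous.tendsto ?_ 0).mono_left nhdsWithin_le_nhds
      fun_prop
    have hev : ∀ᶠ δ in 𝓝[>] (0 : ℝ), sqd 0 zs ≤ ∑ j, (|b j| + 2 * δ) * (|b j| + 2 * δ) := by
      filter_upwards [Ioo_mem_nhdsGT hη] with δ hδ
      exact hupper δ hδ.1 hδ.2
    have h := ge_of_tendsto hF hev
    have e1 : ∑ j, (|b j| + 2 * 0) * (|b j| + 2 * 0) = sqd 0 b := by
      simp only [mul_zero, add_zero, sqd, Pi.zero_apply, sub_zero, abs_mul_abs_self]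
    rwa [e1] at h
  have hzsKc : zs ∈ Kc := by
    rw [hKc]
    refine ⟨hzsK, ?_⟩
    have hbR : sqd 0 b ≤ R := by rw [hKc] at hbKc; exact hbKc.2
    exact hle.trans hbR
  -- eventually the minimiser is regular and lies in the open thickening `⊆ U`
  have hreg_ev : ∀ᶠ p in atTop, LinearIndependent ℝ (fun i => grad (g i) β (z (φ p))) :=
    hlim.eventually ((isOpen_setOf_linearIndependent_grad g β).mem_nhds (hreg zs hzsW))
  have hthick_ev : ∀ᶠ p in atTop, z (φ p) ∈ thickening η Kc := by
    refine hlim.eventually (isOpen_thickening.mem_nhds ?_)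
    exact mem_thickening_iff.2 ⟨zs, hzsKc, by rw [dist_self]; exact hη⟩
  obtain ⟨p, hp1, hp2, hp3⟩ := (hzL.and (hreg_ev.and hthick_ev)).exists
  -- `z (φ p)` is a local minimum on the level set: contradiction with `hbad`
  have hUnhds : U ∈ 𝓝 (z (φ p)) :=
    mem_of_superset (isOpen_thickening.mem_nhds hp3) hthick
  have hloc : IsLocalMinOn (sqd (c (φ p))) (L (φ p)) (z (φ p)) := by
    refine Filter.eventually_iff_exists_mem.2
      ⟨U ∩ L (φ p), Filter.inter_mem (mem_nhdsWithin_of_mem_nhds hUnhds) self_mem_nhdsWithin, ?_⟩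
    intro x hx
    exact isMinOn_iff.1 hp1.2 x hx
  exact hbad (φ p) (z (φ p)) (hzU (φ p)) hp1.1 hp2 hloc

end Khovanskii

end Literature.ModelTheory.ExponentialFields
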